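import Summits.NavierStokesRegularity.NavierStokesRegularity.Theorems.ExtremiserTransiencePinnedDepletionCleanLockedWindowAtScale
import Summits.NavierStokesRegularity.NavierStokesRegularity.Theorems.ExtremiserTransienceDepletedFractionDefs
import Summits.NavierStokesRegularity.NavierStokesRegularity.Theses.ExtremiserTransience
import HarnessLib

/-!
# Crux `NearExtremalTransiencePerFlow` (stmt-NavierStokesRegularity-26567), LINE g13-α `budget_cut` (ns-idea-5 g13):
# THE PINNED SANDWICH AND THE BUDGET CUT, in the kernel on the Theorems side

Theorems file (`--supports stmt-NavierStokesRegularity-26567`, helper; prover seat ns-net-p1 g17) landing §0/§3/§4/§6 of the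
files-only skeleton `Cruxes/NearExtremalTransiencePerFlow/Lines/budget_cut.lean` (ns-idea-5 g13, crux-write ae20d73eeec6; critic of
record idea-crit-4 g10: PASS B, 15:23:42Z) with every statement of the line unfolded VERBATIM (texts §1 :167 K♭ `SmallBudgetDepletion`,
:188 C♭ `CrowdDepletion`, :207 the junction `PinnedDepletedFraction`), so that by-name versions over a Defs file are one-liners by `exact`.

What is proved here (pure logic, monotonicity in `ε`, and the g12-β measure sandwich run with the landed W♭⁺
`PinnedDepletion.cleanLockedWindowAtScale_holds`):

* `nearExtremalTransiencePerFlow_of_pinnedDepletedFraction` — **the REPAIRED heart closes the crux BY NAME**: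
  `PinnedDepletedFraction → NearExtremalTransiencePerFlow`.  The junction `PinnedDepletedFraction` is X♭ `DepletedFraction` (line of
  record g12-β, texts p720463) made PER VIOLATOR (`ε` may depend on the flow) and PINNED (`M = C√ν/√(T−t)`, the Type-I envelope) —
  the repair `C′` endorsed at referee level by idea-crit-4 g10 (15:05:25Z) after the g13 finding that X♭ is refutable AS TYPED
  (`∃ ε ∀ flows` + free window height: near-extremal bulk + vanishing divergence-free ripple + oversized `M`; card §X♭-autopsy).
  Proof: violator frame → W♭⁺'s constants `k, Θ, G, H, c_w` → `ε` → level `m = κ⋆ − min(ε, κ⋆/2)`, cleanliness `ε/2` → W♭⁺'s pinned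
  window at `τ` → `ε|I| ≤ |DEPLETED_ε ∩ I| ≤ |{k ≤ m} ∩ I| ≤ (ε/2)|I|` with `|I| = c_w ν/M² > 0`: absurd.
* `pinnedDepletedFraction_of_budgetCut` — **the budget cut** K♭ ∧ C♭ ⇒ `PinnedDepletedFraction` (C♭ names `N₀`; K♭ at that `N₀` names
  `ε_K`; `ε = min ε_K ε_C`; split each window on `Z(t) ≤ N₀·Mν`; monotonicity of the depleted set in `ε`), and the composition
  `nearExtremalTransiencePerFlow_of_budgetCut` (= the skeleton's `NearExtremalTransiencePerFlow_of hK hC`).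
* `pinnedDepletedFraction_of_depletedFraction` — sanity: the line of record's X♭ implies the junction (the cut asks for LESS).

HONEST FRAMING: statements about hypothetical Type-I singular flows violating the crux; K♭ (flank, XL), the heart C♭, the junction
`PinnedDepletedFraction`, ⟨26567⟩ and NS regularity are OPEN; nothing about Navier–Stokes regularity or blow-up is proved; no summit
is proved by a line. [folklore]
-/

noncomputable section

open scoped Topology InnerProductSpace RealInnerProductSpace ENNReal ContDiff
open MeasureTheory Filter Set Metric
open Literature.Analysis.FluidPDE
open Summit.NavierStokesRegularity.NavierStokesRegularity.Theses.ExtremiserTransience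
open Summit.NavierStokesRegularity.NavierStokesRegularity.Theorems
open Summit.NavierStokesRegularity.NavierStokesRegularity.Theorems.DepletionLadder.KStar.HalfSpace
open Summit.NavierStokesRegularity.NavierStokesRegularity.Theorems.NearExtremalTransiencePerFlow.ZoneTransversality
open Summit.NavierStokesRegularity.NavierStokesRegularity.Theorems.NearExtremalTransiencePerFlow.DepletedFraction

namespace Summit.NavierStokesRegularity.NavierStokesRegularity.Theorems.NearExtremalTransiencePerFlow.PinnedDepletion

-- the summit's namespace repeats the problem name by convention (D-0017)
set_option linter.dupNamespace false

/-! ### §0 Monotonicity of the depleted set / fraction in `ε` -/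

/-- The `ε`-DEPLETED times of `u` (flow-wise clause with coefficient `κ⋆ − ε` at every height bound) GROW as `ε` decreases. [folklore] -/
theorem depleted_mono (u : ℝ → EuclideanSpace ℝ (Fin 3) → EuclideanSpace ℝ (Fin 3)) {ε ε' : ℝ} (h : ε ≤ ε') :
    {t' : ℝ | ∀ M' : ℝ, (∀ x, ‖u t' x‖ ≤ M') →
        |∫ x, ⟪curl (u t') x, fderiv ℝ (u t') x (curl (u t') x)⟫_ℝ| ≤
          (kStar - ε') * M' * Real.sqrt (∫ x, ‖curl (u t') x‖ ^ 2) *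
            Real.sqrt (∫ x, frobeniusNormSq (fderiv ℝ (curl (u t')) x))} ⊆
    {t' : ℝ | ∀ M' : ℝ, (∀ x, ‖u t' x‖ ≤ M') →
        |∫ x, ⟪curl (u t') x, fderiv ℝ (u t') x (curl (u t') x)⟫_ℝ| ≤
          (kStar - ε) * M' * Real.sqrt (∫ x, ‖curl (u t') x‖ ^ 2) *
            Real.sqrt (∫ x, frobeniusNormSq (fderiv ℝ (curl (u t')) x))} := by
  intro t' ht' M' hM'
  have hM'0 : 0 ≤ M' := (norm_nonneg _).trans (hM' 0)
  have hP : 0 ≤ M' * Real.sqrt (∫ x, ‖curl (u t') x‖ ^ 2) *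
      Real.sqrt (∫ x, frobeniusNormSq (fderiv ℝ (curl (u t')) x)) := by positivity
  have hκ : kStar - ε' ≤ kStar - ε := by linarith
  calc |∫ x, ⟪curl (u t') x, fderiv ℝ (u t') x (curl (u t') x)⟫_ℝ|
      ≤ (kStar - ε') * M' * Real.sqrt (∫ x, ‖curl (u t') x‖ ^ 2) *
          Real.sqrt (∫ x, frobeniusNormSq (fderiv ℝ (curl (u t')) x)) := ht' M' hM'
    _ = (kStar - ε') * (M' * Real.sqrt (∫ x, ‖curl (u t') x‖ ^ 2) *
          Real.sqrt (∫ x, frobeniusNormSq (fderiv ℝ (curl (u t')) x))) := by ring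
    _ ≤ (kStar - ε) * (M' * Real.sqrt (∫ x, ‖curl (u t') x‖ ^ 2) *
          Real.sqrt (∫ x, frobeniusNormSq (fderiv ℝ (curl (u t')) x))) := mul_le_mul_of_nonneg_right hκ hP
    _ = (kStar - ε) * M' * Real.sqrt (∫ x, ‖curl (u t') x‖ ^ 2) *
          Real.sqrt (∫ x, frobeniusNormSq (fderiv ℝ (curl (u t')) x)) := by ring

/-- Monotonicity of the depleted FRACTION claim in `ε`: a lower bound at `ε'` on a window `I` gives the lower bound at every
`ε ≤ ε'` (for `L ≥ 0`). [folklore] -/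
theorem fraction_mono (u : ℝ → EuclideanSpace ℝ (Fin 3) → EuclideanSpace ℝ (Fin 3)) {ε ε' L : ℝ} (I : Set ℝ)
    (h : ε ≤ ε') (hL : 0 ≤ L)
    (hfrac : ENNReal.ofReal (ε' * L) ≤
      volume ({t' : ℝ | ∀ M' : ℝ, (∀ x, ‖u t' x‖ ≤ M') →
        |∫ x, ⟪curl (u t') x, fderiv ℝ (u t') x (curl (u t') x)⟫_ℝ| ≤
          (kStar - ε') * M' * Real.sqrt (∫ x, ‖curl (u t') x‖ ^ 2) *
            Real.sqrt (∫ x, frobeniusNormSq (fderiv ℝ (curl (u t')) x))} ∩ I)) :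
    ENNReal.ofReal (ε * L) ≤
      volume ({t' : ℝ | ∀ M' : ℝ, (∀ x, ‖u t' x‖ ≤ M') →
        |∫ x, ⟪curl (u t') x, fderiv ℝ (u t') x (curl (u t') x)⟫_ℝ| ≤
          (kStar - ε) * M' * Real.sqrt (∫ x, ‖curl (u t') x‖ ^ 2) *
            Real.sqrt (∫ x, frobeniusNormSq (fderiv ℝ (curl (u t')) x))} ∩ I) := by
  have h1 : ENNReal.ofReal (ε * L) ≤ ENNReal.ofReal (ε' * L) :=
    ENNReal.ofReal_le_ofReal (mul_le_mul_of_nonneg_right h hL)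
  exact h1.trans (hfrac.trans (measure_mono (Set.inter_subset_inter_left _ (depleted_mono u h))))

/-! ### §1 The budget cut: K♭ ∧ C♭ ⇒ the junction `PinnedDepletedFraction` (pure logic + monotonicity in `ε`) -/

/-- **The budget cut** (`budget_cut.lean` §3 `pinnedDepletedFraction_of`, statements VERBATIM): K♭ `SmallBudgetDepletion` (pinned
admissible windows of a violator whose start slice has `Z(t) ≤ N₀·(Mν)` deplete, `∀ N₀ ∃ ε`) and C♭ `CrowdDepletion` (`∃ N₀ ε`: windows
with `N₀·(Mν) ≤ Z(t)` deplete) imply `PinnedDepletedFraction`: C♭ names `N₀`; K♭ at that `N₀` names `ε_K`; take `ε = min ε_K ε_C` and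
split each window on `Z(t) ≤ N₀·Mν`. [folklore] -/
theorem pinnedDepletedFraction_of_budgetCut
    (hK : ∀ (C ν T : ℝ) (u : ℝ → EuclideanSpace ℝ (Fin 3) → EuclideanSpace ℝ (Fin 3)) (p : ℝ → EuclideanSpace ℝ (Fin 3) → ℝ),
      IsViolator C ν T u p →
      ∀ (Θ G H τ₁ N₀ : ℝ), 0 < Θ → 0 < G → 0 < H → 0 < τ₁ → 0 < N₀ → ∃ ε : ℝ, 0 < ε ∧
      ∀ (t M : ℝ), 0 ≤ t → 0 < M → t + τ₁ * ν / M ^ 2 < T → M = C * Real.sqrt ν / Real.sqrt (T - t) →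
        (∀ x, ‖u t x‖ ≤ M) →
        (∫ x, ‖curl (u t) x‖ ^ 2) ≤ Θ * (ν / M) ^ 2 * (∫ x, frobeniusNormSq (fderiv ℝ (curl (u t)) x)) →
        (∀ x, ‖fderiv ℝ (u t) x‖ ≤ G * M ^ 2 / ν) →
        (∀ t' ∈ Set.Icc t (t + τ₁ * ν / M ^ 2), ∀ x, ‖u t' x‖ ≤ H * M) →
        (∫ x, ‖curl (u t) x‖ ^ 2) ≤ N₀ * (M * ν) →
        ENNReal.ofReal (ε * (τ₁ * ν / M ^ 2)) ≤
          volume ({t' : ℝ | ∀ M' : ℝ, (∀ x, ‖u t' x‖ ≤ M') →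
              |∫ x, ⟪curl (u t') x, fderiv ℝ (u t') x (curl (u t') x)⟫_ℝ| ≤
                (kStar - ε) * M' * Real.sqrt (∫ x, ‖curl (u t') x‖ ^ 2) *
                  Real.sqrt (∫ x, frobeniusNormSq (fderiv ℝ (curl (u t')) x))} ∩
            Set.Icc t (t + τ₁ * ν / M ^ 2)))
    (hC : ∀ (C ν T : ℝ) (u : ℝ → EuclideanSpace ℝ (Fin 3) → EuclideanSpace ℝ (Fin 3)) (p : ℝ → EuclideanSpace ℝ (Fin 3) → ℝ),
      IsViolator C ν T u p →
      ∀ (Θ G H τ₁ : ℝ), 0 < Θ → 0 < G → 0 < H → 0 < τ₁ → ∃ N₀ ε : ℝ, 0 < N₀ ∧ 0 < ε ∧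
      ∀ (t M : ℝ), 0 ≤ t → 0 < M → t + τ₁ * ν / M ^ 2 < T → M = C * Real.sqrt ν / Real.sqrt (T - t) →
        (∀ x, ‖u t x‖ ≤ M) →
        (∫ x, ‖curl (u t) x‖ ^ 2) ≤ Θ * (ν / M) ^ 2 * (∫ x, frobeniusNormSq (fderiv ℝ (curl (u t)) x)) →
        (∀ x, ‖fderiv ℝ (u t) x‖ ≤ G * M ^ 2 / ν) →
        (∀ t' ∈ Set.Icc t (t + τ₁ * ν / M ^ 2), ∀ x, ‖u t' x‖ ≤ H * M) →
        N₀ * (M * ν) ≤ (∫ x, ‖curl (u t) x‖ ^ 2) →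
        ENNReal.ofReal (ε * (τ₁ * ν / M ^ 2)) ≤
          volume ({t' : ℝ | ∀ M' : ℝ, (∀ x, ‖u t' x‖ ≤ M') →
              |∫ x, ⟪curl (u t') x, fderiv ℝ (u t') x (curl (u t') x)⟫_ℝ| ≤
                (kStar - ε) * M' * Real.sqrt (∫ x, ‖curl (u t') x‖ ^ 2) *
                  Real.sqrt (∫ x, frobeniusNormSq (fderiv ℝ (curl (u t')) x))} ∩
            Set.Icc t (t + τ₁ * ν / M ^ 2))) :
    ∀ (C ν T : ℝ) (u : ℝ → EuclideanSpace ℝ (Fin 3) → EuclideanSpace ℝ (Fin 3)) (p : ℝ → EuclideanSpace ℝ (Fin 3) → ℝ),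
      IsViolator C ν T u p →
      ∀ (Θ G H τ₁ : ℝ), 0 < Θ → 0 < G → 0 < H → 0 < τ₁ → ∃ ε : ℝ, 0 < ε ∧
      ∀ (t M : ℝ), 0 ≤ t → 0 < M → t + τ₁ * ν / M ^ 2 < T → M = C * Real.sqrt ν / Real.sqrt (T - t) →
        (∀ x, ‖u t x‖ ≤ M) →
        (∫ x, ‖curl (u t) x‖ ^ 2) ≤ Θ * (ν / M) ^ 2 * (∫ x, frobeniusNormSq (fderiv ℝ (curl (u t)) x)) →
        (∀ x, ‖fderiv ℝ (u t) x‖ ≤ G * M ^ 2 / ν) →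
        (∀ t' ∈ Set.Icc t (t + τ₁ * ν / M ^ 2), ∀ x, ‖u t' x‖ ≤ H * M) →
        ENNReal.ofReal (ε * (τ₁ * ν / M ^ 2)) ≤
          volume ({t' : ℝ | ∀ M' : ℝ, (∀ x, ‖u t' x‖ ≤ M') →
              |∫ x, ⟪curl (u t') x, fderiv ℝ (u t') x (curl (u t') x)⟫_ℝ| ≤
                (kStar - ε) * M' * Real.sqrt (∫ x, ‖curl (u t') x‖ ^ 2) *
                  Real.sqrt (∫ x, frobeniusNormSq (fderiv ℝ (curl (u t')) x))} ∩
            Set.Icc t (t + τ₁ * ν / M ^ 2)) := by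
  intro C ν T u p hV Θ G H τ₁ hΘ hG hH hτ₁
  have hν : 0 < ν := hV.2.1
  obtain ⟨N₀, εC, hN₀, hεC, hC1⟩ := hC C ν T u p hV Θ G H τ₁ hΘ hG hH hτ₁
  obtain ⟨εK, hεK, hK1⟩ := hK C ν T u p hV Θ G H τ₁ N₀ hΘ hG hH hτ₁ hN₀
  refine ⟨min εK εC, lt_min hεK hεC, ?_⟩
  intro t M ht hM htT hpin hMb hlock hgrad hheights
  have hL : 0 ≤ τ₁ * ν / M ^ 2 := by positivity
  rcases le_or_gt (∫ x, ‖curl (u t) x‖ ^ 2) (N₀ * (M * ν)) with hsmall | hbig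
  · have h := hK1 t M ht hM htT hpin hMb hlock hgrad hheights hsmall
    exact fraction_mono u (Set.Icc t (t + τ₁ * ν / M ^ 2)) (min_le_left _ _) hL h
  · have h := hC1 t M ht hM htT hpin hMb hlock hgrad hheights hbig.le
    exact fraction_mono u (Set.Icc t (t + τ₁ * ν / M ^ 2)) (min_le_right _ _) hL h

/-! ### §2 The sandwich: the junction `PinnedDepletedFraction` closes the crux BY NAME -/

/-- **The repaired heart closes the crux BY NAME** (`budget_cut.lean` §6 / `relay.lean` §5 `nearExtremalTransiencePerFlow_of_pinned`,
hypothesis = the junction `PinnedDepletedFraction` VERBATIM): if every violator has, for every window package `(Θ, G, H, τ₁)`, a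
fraction `ε > 0` such that every PINNED admissible window (`M = C√ν/√(T−t)`, Taylor lock, gradient, heights) carries `ε`-depleted times
of measure `≥ ε|I|`, then `NearExtremalTransiencePerFlow`.  Proof: the g12-β measure sandwich run with W♭⁺
`cleanLockedWindowAtScale_holds`: `ε|I| ≤ |DEPLETED_ε ∩ I| ≤ |{k ≤ κ⋆ − min(ε,κ⋆/2)} ∩ I| ≤ (ε/2)|I|`, `|I| = c_w ν/M² > 0`. [folklore] -/
theorem nearExtremalTransiencePerFlow_of_pinnedDepletedFraction
    (hX : ∀ (C ν T : ℝ) (u : ℝ → EuclideanSpace ℝ (Fin 3) → EuclideanSpace ℝ (Fin 3)) (p : ℝ → EuclideanSpace ℝ (Fin 3) → ℝ),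
      IsViolator C ν T u p →
      ∀ (Θ G H τ₁ : ℝ), 0 < Θ → 0 < G → 0 < H → 0 < τ₁ → ∃ ε : ℝ, 0 < ε ∧
      ∀ (t M : ℝ), 0 ≤ t → 0 < M → t + τ₁ * ν / M ^ 2 < T → M = C * Real.sqrt ν / Real.sqrt (T - t) →
        (∀ x, ‖u t x‖ ≤ M) →
        (∫ x, ‖curl (u t) x‖ ^ 2) ≤ Θ * (ν / M) ^ 2 * (∫ x, frobeniusNormSq (fderiv ℝ (curl (u t)) x)) →
        (∀ x, ‖fderiv ℝ (u t) x‖ ≤ G * M ^ 2 / ν) →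
        (∀ t' ∈ Set.Icc t (t + τ₁ * ν / M ^ 2), ∀ x, ‖u t' x‖ ≤ H * M) →
        ENNReal.ofReal (ε * (τ₁ * ν / M ^ 2)) ≤
          volume ({t' : ℝ | ∀ M' : ℝ, (∀ x, ‖u t' x‖ ≤ M') →
              |∫ x, ⟪curl (u t') x, fderiv ℝ (u t') x (curl (u t') x)⟫_ℝ| ≤
                (kStar - ε) * M' * Real.sqrt (∫ x, ‖curl (u t') x‖ ^ 2) *
                  Real.sqrt (∫ x, frobeniusNormSq (fderiv ℝ (curl (u t')) x))} ∩
            Set.Icc t (t + τ₁ * ν / M ^ 2))) :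
    NearExtremalTransiencePerFlow := by
  have hW := cleanLockedWindowAtScale_holds
  intro C ν T hC hν hT u p hsol hLH hdec hrate hsing
  by_contra hno
  have hV : IsViolator C ν T u p := ⟨hC, hν, hT, hsol, hLH, hdec, hrate, hsing, hno⟩
  obtain ⟨k, Θ, G, H, c_w, hkeff, hΘ, hGpos, hH, hcw, hwin⟩ := hW C ν T u p hV
  -- the fraction `ε` for THIS violator at window length `τ₁ = c_w`
  obtain ⟨ε, hε, hX1⟩ := hX C ν T u p hV Θ G H c_w hΘ hGpos hH hcw
  have hK : 0 < kStar := kStar_pos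
  obtain ⟨e, hedef⟩ : ∃ e : ℝ, e = min ε (kStar / 2) := ⟨_, rfl⟩
  have hepos : 0 < e := by rw [hedef]; exact lt_min hε (by linarith)
  have heε : e ≤ ε := by rw [hedef]; exact min_le_left _ _
  have heK : e ≤ kStar / 2 := by rw [hedef]; exact min_le_right _ _
  obtain ⟨m, hmdef⟩ : ∃ m : ℝ, m = kStar - e := ⟨_, rfl⟩
  have hm_lo : kStar / 2 ≤ m := by linarith
  have hm_lt : m < kStar := by linarith
  have hm0 : 0 ≤ m := by linarith
  have hmε : kStar - ε ≤ m := by linarith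
  have hη : 0 < ε / 2 := by linarith
  obtain ⟨τ, M, hτ0, hM0, hτT, hpin, hMb, hlock, hgrad, hheights, hclean⟩ :=
    hwin m hm_lo hm_lt (ε / 2) hη c_w hcw le_rfl
  have hfrac := hX1 τ M hτ0 hM0 hτT hpin hMb hlock hgrad hheights
  -- read-back: a depleted time of the window is an inefficient time (`k ≤ m`)
  have hsub : ({t' : ℝ | ∀ M' : ℝ, (∀ x, ‖u t' x‖ ≤ M') →
        |∫ x, ⟪curl (u t') x, fderiv ℝ (u t') x (curl (u t') x)⟫_ℝ| ≤
          (kStar - ε) * M' * Real.sqrt (∫ x, ‖curl (u t') x‖ ^ 2) *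
            Real.sqrt (∫ x, frobeniusNormSq (fderiv ℝ (curl (u t')) x))} ∩
        Set.Icc τ (τ + c_w * ν / M ^ 2)) ⊆
      ({σ : ℝ | k σ ≤ m} ∩ Set.Icc τ (τ + c_w * ν / M ^ 2)) := by
    rintro t' ⟨hdep, ht'I⟩
    refine ⟨?_, ht'I⟩
    have ht'0 : 0 ≤ t' := hτ0.trans ht'I.1
    have ht'T : t' < T := lt_of_le_of_lt ht'I.2 hτT
    show k t' ≤ m
    by_contra hlt
    push Not at hlt
    obtain ⟨M', hM', hstr⟩ := hkeff t' ⟨ht'0, ht'T⟩ m hm0 hlt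
    have hM'0 : 0 ≤ M' := (norm_nonneg _).trans (hM' 0)
    have hle := hdep M' hM'
    have hP' : 0 ≤ M' * Real.sqrt (∫ x, ‖curl (u t') x‖ ^ 2) *
        Real.sqrt (∫ x, frobeniusNormSq (fderiv ℝ (curl (u t')) x)) := by positivity
    have hmono : (kStar - ε) * M' * Real.sqrt (∫ x, ‖curl (u t') x‖ ^ 2) *
        Real.sqrt (∫ x, frobeniusNormSq (fderiv ℝ (curl (u t')) x)) ≤
        m * M' * Real.sqrt (∫ x, ‖curl (u t') x‖ ^ 2) *
        Real.sqrt (∫ x, frobeniusNormSq (fderiv ℝ (curl (u t')) x)) := by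
      have h := mul_le_mul_of_nonneg_right hmε hP'
      calc (kStar - ε) * M' * Real.sqrt (∫ x, ‖curl (u t') x‖ ^ 2) *
            Real.sqrt (∫ x, frobeniusNormSq (fderiv ℝ (curl (u t')) x))
          = (kStar - ε) * (M' * Real.sqrt (∫ x, ‖curl (u t') x‖ ^ 2) *
            Real.sqrt (∫ x, frobeniusNormSq (fderiv ℝ (curl (u t')) x))) := by ring
        _ ≤ m * (M' * Real.sqrt (∫ x, ‖curl (u t') x‖ ^ 2) *
            Real.sqrt (∫ x, frobeniusNormSq (fderiv ℝ (curl (u t')) x))) := h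
        _ = m * M' * Real.sqrt (∫ x, ‖curl (u t') x‖ ^ 2) *
            Real.sqrt (∫ x, frobeniusNormSq (fderiv ℝ (curl (u t')) x)) := by ring
    exact absurd (lt_of_lt_of_le hstr (hle.trans hmono)) (lt_irrefl _)
  have hcmp : ENNReal.ofReal (ε * (c_w * ν / M ^ 2)) ≤ ENNReal.ofReal (ε / 2 * (c_w * ν / M ^ 2)) :=
    (hfrac.trans (measure_mono hsub)).trans hclean
  have hI : 0 < c_w * ν / M ^ 2 := by positivity
  have hrhs : 0 ≤ ε / 2 * (c_w * ν / M ^ 2) := by positivity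
  have hreal : ε * (c_w * ν / M ^ 2) ≤ ε / 2 * (c_w * ν / M ^ 2) := (ENNReal.ofReal_le_ofReal_iff hrhs).1 hcmp
  nlinarith [hreal, hI, hε]

/-- **LINE g13-α `budget_cut` COMPOSITION on the Theorems side** (= the skeleton's `NearExtremalTransiencePerFlow_of hK hC`, stubs
VERBATIM): K♭ `SmallBudgetDepletion` and C♭ `CrowdDepletion` conclude the crux `NearExtremalTransiencePerFlow` BY NAME, through the
budget cut and the pinned sandwich. [folklore] -/
theorem nearExtremalTransiencePerFlow_of_budgetCut
    (hK : ∀ (C ν T : ℝ) (u : ℝ → EuclideanSpace ℝ (Fin 3) → EuclideanSpace ℝ (Fin 3)) (p : ℝ → EuclideanSpace ℝ (Fin 3) → ℝ),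
      IsViolator C ν T u p →
      ∀ (Θ G H τ₁ N₀ : ℝ), 0 < Θ → 0 < G → 0 < H → 0 < τ₁ → 0 < N₀ → ∃ ε : ℝ, 0 < ε ∧
      ∀ (t M : ℝ), 0 ≤ t → 0 < M → t + τ₁ * ν / M ^ 2 < T → M = C * Real.sqrt ν / Real.sqrt (T - t) →
        (∀ x, ‖u t x‖ ≤ M) →
        (∫ x, ‖curl (u t) x‖ ^ 2) ≤ Θ * (ν / M) ^ 2 * (∫ x, frobeniusNormSq (fderiv ℝ (curl (u t)) x)) →
        (∀ x, ‖fderiv ℝ (u t) x‖ ≤ G * M ^ 2 / ν) →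
        (∀ t' ∈ Set.Icc t (t + τ₁ * ν / M ^ 2), ∀ x, ‖u t' x‖ ≤ H * M) →
        (∫ x, ‖curl (u t) x‖ ^ 2) ≤ N₀ * (M * ν) →
        ENNReal.ofReal (ε * (τ₁ * ν / M ^ 2)) ≤
          volume ({t' : ℝ | ∀ M' : ℝ, (∀ x, ‖u t' x‖ ≤ M') →
              |∫ x, ⟪curl (u t') x, fderiv ℝ (u t') x (curl (u t') x)⟫_ℝ| ≤
                (kStar - ε) * M' * Real.sqrt (∫ x, ‖curl (u t') x‖ ^ 2) *
                  Real.sqrt (∫ x, frobeniusNormSq (fderiv ℝ (curl (u t')) x))} ∩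
            Set.Icc t (t + τ₁ * ν / M ^ 2)))
    (hC : ∀ (C ν T : ℝ) (u : ℝ → EuclideanSpace ℝ (Fin 3) → EuclideanSpace ℝ (Fin 3)) (p : ℝ → EuclideanSpace ℝ (Fin 3) → ℝ),
      IsViolator C ν T u p →
      ∀ (Θ G H τ₁ : ℝ), 0 < Θ → 0 < G → 0 < H → 0 < τ₁ → ∃ N₀ ε : ℝ, 0 < N₀ ∧ 0 < ε ∧
      ∀ (t M : ℝ), 0 ≤ t → 0 < M → t + τ₁ * ν / M ^ 2 < T → M = C * Real.sqrt ν / Real.sqrt (T - t) →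
        (∀ x, ‖u t x‖ ≤ M) →
        (∫ x, ‖curl (u t) x‖ ^ 2) ≤ Θ * (ν / M) ^ 2 * (∫ x, frobeniusNormSq (fderiv ℝ (curl (u t)) x)) →
        (∀ x, ‖fderiv ℝ (u t) x‖ ≤ G * M ^ 2 / ν) →
        (∀ t' ∈ Set.Icc t (t + τ₁ * ν / M ^ 2), ∀ x, ‖u t' x‖ ≤ H * M) →
        N₀ * (M * ν) ≤ (∫ x, ‖curl (u t) x‖ ^ 2) →
        ENNReal.ofReal (ε * (τ₁ * ν / M ^ 2)) ≤
          volume ({t' : ℝ | ∀ M' : ℝ, (∀ x, ‖u t' x‖ ≤ M') →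
              |∫ x, ⟪curl (u t') x, fderiv ℝ (u t') x (curl (u t') x)⟫_ℝ| ≤
                (kStar - ε) * M' * Real.sqrt (∫ x, ‖curl (u t') x‖ ^ 2) *
                  Real.sqrt (∫ x, frobeniusNormSq (fderiv ℝ (curl (u t')) x))} ∩
            Set.Icc t (t + τ₁ * ν / M ^ 2))) :
    NearExtremalTransiencePerFlow :=
  nearExtremalTransiencePerFlow_of_pinnedDepletedFraction (pinnedDepletedFraction_of_budgetCut hK hC)

/-! ### §3 Sanity: the repaired heart asks for LESS than the line of record -/

/-- **X♭ ⇒ the junction** (`budget_cut.lean` §4 `pinnedDepletedFraction_of_depletedFraction`): the line of record's heart X♭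
`DepletedFraction` (texts p720463; `∃ ε` BEFORE `∀ flows`, free height bound `M`) implies `PinnedDepletedFraction` (per violator,
pinned) — instantiate X♭ in the violator's flow and forget the pin. [folklore] -/
theorem pinnedDepletedFraction_of_depletedFraction (hX : DepletedFraction) :
    ∀ (C ν T : ℝ) (u : ℝ → EuclideanSpace ℝ (Fin 3) → EuclideanSpace ℝ (Fin 3)) (p : ℝ → EuclideanSpace ℝ (Fin 3) → ℝ),
      IsViolator C ν T u p →
      ∀ (Θ G H τ₁ : ℝ), 0 < Θ → 0 < G → 0 < H → 0 < τ₁ → ∃ ε : ℝ, 0 < ε ∧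
      ∀ (t M : ℝ), 0 ≤ t → 0 < M → t + τ₁ * ν / M ^ 2 < T → M = C * Real.sqrt ν / Real.sqrt (T - t) →
        (∀ x, ‖u t x‖ ≤ M) →
        (∫ x, ‖curl (u t) x‖ ^ 2) ≤ Θ * (ν / M) ^ 2 * (∫ x, frobeniusNormSq (fderiv ℝ (curl (u t)) x)) →
        (∀ x, ‖fderiv ℝ (u t) x‖ ≤ G * M ^ 2 / ν) →
        (∀ t' ∈ Set.Icc t (t + τ₁ * ν / M ^ 2), ∀ x, ‖u t' x‖ ≤ H * M) →
        ENNReal.ofReal (ε * (τ₁ * ν / M ^ 2)) ≤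
          volume ({t' : ℝ | ∀ M' : ℝ, (∀ x, ‖u t' x‖ ≤ M') →
              |∫ x, ⟪curl (u t') x, fderiv ℝ (u t') x (curl (u t') x)⟫_ℝ| ≤
                (kStar - ε) * M' * Real.sqrt (∫ x, ‖curl (u t') x‖ ^ 2) *
                  Real.sqrt (∫ x, frobeniusNormSq (fderiv ℝ (curl (u t')) x))} ∩
            Set.Icc t (t + τ₁ * ν / M ^ 2)) := by
  intro C ν T u p hV Θ G H τ₁ hΘ hG hH hτ₁
  obtain ⟨ε, hε, h1⟩ := hX Θ G H τ₁ hΘ hG hH hτ₁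
  exact ⟨ε, hε, fun t M ht hM htT _hpin hMb hlock hgrad hheights =>
    h1 ν T hV.2.1 hV.2.2.1 u p hV.2.2.2.1 hV.2.2.2.2.1 hV.2.2.2.2.2.1 t M ht hM htT hMb hlock hgrad hheights⟩

/-- The line of record's heart X♭ `DepletedFraction` therefore also closes the crux BY NAME through the pinned sandwich
(consistency with the registered skeleton `depleted_fraction`; X♭ is OPEN and, per the g13 finding, refutable as typed). [folklore] -/
theorem nearExtremalTransiencePerFlow_of_depletedFraction (hX : DepletedFraction) : NearExtremalTransiencePerFlow :=
  nearExtremalTransiencePerFlow_of_pinnedDepletedFraction (pinnedDepletedFraction_of_depletedFraction hX)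

end Summit.NavierStokesRegularity.NavierStokesRegularity.Theorems.NearExtremalTransiencePerFlow.PinnedDepletion

end
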